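import Summits.ResolutionOfSingularities.ResolutionOfSingularities.Theorems.WildConesClassicalRegimesStubMuDropCharTwoOrdPNoether

/-!
# Milnor drop in characteristic two (`stub_muDropCharTwoOrdP`) — helper 8/8: Surface

Helper file for the stub `stub_muDropCharTwoOrdP` of crux `ClassicalRegimes`
(stmt-ResolutionOfSingularities-16884, route `WildCones`, line `milnor-descent`): the one-step drop
of the Milnor number `μ = dim_κ κ⟦u₁,…,uₙ⟧/(∂a)` of the cleaned state of `z² = a(u)` under the
point-blow-up dynamics in characteristic two, `n ≥ 3`. The proof works on formal power series:
a hyperbolic pair `u_j u_l` of the quadratic part of `a` is split off by the formal coordinate change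
`u_j ↦ q⁻¹ ∂_l a, u_l ↦ q⁻¹ ∂_j a` (formal inverse function theorem; `∂_j ∂_j = 0` in
characteristic two makes `∂_j ã ∈ (u_l)`, `∂_l ã ∈ (u_j)`), which commutes with the strict
transform; killing `u_j, u_l` descends to `n - 2` variables with the same Milnor algebras. The
leaves: `n ≥ 3` residual variables without hyperbolic pair are not isolated (Case A), `n = 1` is
`μ = ord - 1`, and `n = 2` is Max Noether's inequality `I(∂ₓa, ∂_y a) ≥ m m' + I(strict transforms)`
at the point of the exceptional line plus the multiplicity `≤ 3` of that line in `(∂G)`.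
Sources: G.-M. Greuel, G. Pfister, *The splitting lemma in any characteristic*, J. Algebra 689
(2026) = arXiv:2507.17078, Thm. 3.5 / Cor. 3.7 (the hyperbolic pair; only its linear part is used);
E. Casas-Alvero, *Singularities of Plane Curves*, §3 (Noether's formula); folklore otherwise.

This file: the surface leaf (`n = 2`, characteristic two): the shear to slope `0` preserves the Milnor algebra and the vanishing of the `x y`-coefficient, and the drop `μ(G) ≤ μ(a) - 1` from Max Noether's inequality and the multiplicity `≤ 3` of the exceptional line in `(∂G)`.
-/

noncomputable section

-- single-problem summit: the doubled namespace component `ResolutionOfSingularities` is forced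
set_option linter.dupNamespace false

open scoped BigOperators Classical

open MvPowerSeries IsLocalRing

open Literature.AlgebraicGeometry.Resolution

namespace Summit.ResolutionOfSingularities.ResolutionOfSingularities.Theorems.WildCones

namespace MuDropCharTwoOrdP

variable {κ : Type} [Field κ]

section Surface

/-- THE SHEAR `y ↦ y + t x` transports a state to the chart of slope `0` without changing the
Milnor algebra, the order, or the vanishing of the `x y`-coefficient (char. two). [folklore] -/
theorem shear_transfer [CharP κ 2] (t : κ) {a : MvPowerSeries (Fin 2) κ} (ha : 2 ≤ a.order)
    (hnopair : coeff (Finsupp.single 0 1 + Finsupp.single 1 1) a = 0) :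
    ∃ a₁ : MvPowerSeries (Fin 2) κ,
      subst (PlaneGerm.dirChart t) a = subst (![X 0, X 0 * X 1] : Fin 2 → MvPowerSeries (Fin 2) κ) a₁ ∧
      2 ≤ a₁.order ∧ coeff (Finsupp.single 0 1 + Finsupp.single 1 1) a₁ = 0 ∧
      Nonempty ((MvPowerSeries (Fin 2) κ ⧸ Ideal.span (Set.range fun s => MvPowerSeries.pderiv s a)) ≃ₐ[κ]
        (MvPowerSeries (Fin 2) κ ⧸ Ideal.span (Set.range fun s => MvPowerSeries.pderiv s a₁))) := by
  have finTwo_eq : ∀ e : Fin 2 →₀ ℕ, e = Finsupp.single 0 (e 0) + Finsupp.single 1 (e 1) := fun e =>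
    Finsupp.ext fun s => by fin_cases s <;> simp
  have finTwo_degree : ∀ e : Fin 2 →₀ ℕ, e.degree = e 0 + e 1 := fun e => by
    rw [Finsupp.degree_eq_sum, Fin.sum_univ_two]
  have range_fin_two : ∀ {α : Type} (h : Fin 2 → α), Set.range h = {h 0, h 1} := fun h => by
    ext x
    simp only [Set.mem_range, Set.mem_insert_iff, Set.mem_singleton_iff]
    constructor
    · rintro ⟨s, rfl⟩; fin_cases s <;> simp
    · rintro (rfl | rfl) <;> exact ⟨_, rfl⟩
  have h0 := PlaneGerm.constantCoeff_shearX (k := κ) t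
  obtain ⟨L, hL⟩ := exists_algEquiv_of_subst _ h0 (PlaneGerm.isUnit_det_shearX t)
  have hLsub : HasSubst (![X 0, X 1 + C t * X 0] : Fin 2 → MvPowerSeries (Fin 2) κ) :=
    hasSubst_of_constantCoeff_zero h0
  refine ⟨L a, by rw [hL, PlaneGerm.subst_dirChart], le_order_algEquiv L ha, ?_, ?_⟩
  · -- the `x y`-coefficient
    haveI : CharP (MvPowerSeries (Fin 2) κ) 2 := charP_of_injective_ringHom (C_injective (σ := Fin 2) (R := κ)) 2
    have ha' := (FormalCoordChange.two_le_order_iff a).mp ha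
    set q : MvPowerSeries (Fin 2) κ := C (coeff (Finsupp.single 0 2) a) * X 0 ^ 2 +
      C (coeff (Finsupp.single 1 2) a) * X 1 ^ 2 with hq
    have hcXsq : ∀ (c : κ) (s : Fin 2) (E : Fin 2 →₀ ℕ), coeff E (C c * X s ^ 2) =
        if E = Finsupp.single s 2 then c else 0 := by
      intro c s E
      rw [coeff_C_mul, X_pow_eq, coeff_monomial]
      split_ifs <;> simp
    have h11 : ∀ s : Fin 2, (Finsupp.single 0 1 + Finsupp.single 1 1 : Fin 2 →₀ ℕ) ≠ Finsupp.single s 2 := by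
      intro s h
      have h' := DFunLike.congr_fun h s
      fin_cases s <;> simp at h'
    have hr : ((3 : ℕ) : ℕ∞) ≤ (a - q).order := by
      apply nat_le_order
      intro E hE
      rw [map_sub, hq, map_add, hcXsq, hcXsq]
      rw [finTwo_degree] at hE
      by_cases h0 : E 0 + E 1 = 0
      · have : E = 0 := by rw [finTwo_eq E]; simp [show E 0 = 0 by omega, show E 1 = 0 by omega]
        subst this
        rw [if_neg (fun h => (Finsupp.single_ne_zero.mpr two_ne_zero) h.symm),
          if_neg (fun h => (Finsupp.single_ne_zero.mpr two_ne_zero) h.symm)]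
        simp [ha'.1]
      by_cases h1 : E 0 + E 1 = 1
      · have hE' : E = Finsupp.single 0 1 ∨ E = Finsupp.single 1 1 := by
          rw [finTwo_eq E]
          rcases Nat.eq_zero_or_pos (E 0) with h | h
          · right; simp [h, show E 1 = 1 by omega]
          · left; simp [show E 0 = 1 by omega, show E 1 = 0 by omega]
        rcases hE' with rfl | rfl
        · rw [ha'.2 0, if_neg (by intro h; have := DFunLike.congr_fun h 0; simp at this),
            if_neg (by intro h; have := DFunLike.congr_fun h 0; simp at this)]; ring
        · rw [ha'.2 1, if_neg (by intro h; have := DFunLike.congr_fun h 1; simp at this),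
            if_neg (by intro h; have := DFunLike.congr_fun h 1; simp at this)]; ring
      · have h2 : E 0 + E 1 = 2 := by omega
        have hE' : E = Finsupp.single 0 2 ∨ E = Finsupp.single 1 2 ∨
            E = Finsupp.single 0 1 + Finsupp.single 1 1 := by
          rw [finTwo_eq E]
          rcases Nat.eq_zero_or_pos (E 0) with h | h
          · right; left; simp [h, show E 1 = 2 by omega]
          · rcases Nat.eq_zero_or_pos (E 1) with h' | h'
            · left; simp [h', show E 0 = 2 by omega]
            · right; right; simp [show E 0 = 1 by omega, show E 1 = 1 by omega]
        rcases hE' with rfl | rfl | rfl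
        · rw [if_pos rfl, if_neg (by intro h; have := DFunLike.congr_fun h 0; simp at this)]; ring
        · rw [if_neg (by intro h; have := DFunLike.congr_fun h 0; simp at this), if_pos rfl]; ring
        · rw [hnopair, if_neg (h11 0), if_neg (h11 1)]; ring
    have hsplit : L a = L q + L (a - q) := by rw [← map_add, add_sub_cancel]
    have hLr : coeff (Finsupp.single 0 1 + Finsupp.single 1 1) (L (a - q)) = 0 := by
      apply coeff_of_lt_order
      refine lt_of_lt_of_le ?_ (le_order_algEquiv L hr)
      rw [finTwo_degree, (finTwo_pair_apply 1 1).1, (finTwo_pair_apply 1 1).2]; norm_num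
    have hLq : L q = C (coeff (Finsupp.single 0 2) a) * X 0 ^ 2 +
        C (coeff (Finsupp.single 1 2) a) * X 1 ^ 2 + C (coeff (Finsupp.single 1 2) a * t ^ 2) * X 0 ^ 2 := by
      rw [hL, hq, subst_add hLsub, subst_mul hLsub, subst_mul hLsub, subst_C, subst_C, subst_pow hLsub,
        subst_pow hLsub, subst_X hLsub, subst_X hLsub]
      simp only [Matrix.cons_val_zero, Matrix.cons_val_one]
      rw [CharTwo.add_sq, mul_pow, ← map_pow, map_mul]
      ring
    rw [hsplit, map_add, hLr, add_zero, hLq, map_add, map_add, hcXsq, hcXsq, hcXsq, if_neg (h11 0),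
      if_neg (h11 1), if_neg (h11 0), add_zero, add_zero]
  · -- the Milnor algebras
    refine ⟨Ideal.quotientEquivAlg _ _ L ?_⟩
    rw [Ideal.map_span, ← Set.range_comp, range_fin_two, range_fin_two]
    simp only [Function.comp_apply]
    have hcr : ∀ m, MvPowerSeries.pderiv m (L a) =
        ∑ s, L (MvPowerSeries.pderiv s a) * MvPowerSeries.pderiv m
          ((![X 0, X 1 + C t * X 0] : Fin 2 → MvPowerSeries (Fin 2) κ) s) := by
      intro m
      rw [hL, MvPowerSeries.pderiv_subst h0]
      simp only [hL]
    have h0' : MvPowerSeries.pderiv 0 (L a) = L (MvPowerSeries.pderiv 0 a) + C t * L (MvPowerSeries.pderiv 1 a) := by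
      rw [hcr, Fin.sum_univ_two]
      simp only [Matrix.cons_val_zero, Matrix.cons_val_one, map_add, MvPowerSeries.pderiv_X,
        Derivation.leibniz, pderiv_C, smul_eq_mul]
      simp
      ring
    have h1' : MvPowerSeries.pderiv 1 (L a) = L (MvPowerSeries.pderiv 1 a) := by
      rw [hcr, Fin.sum_univ_two]
      simp only [Matrix.cons_val_zero, Matrix.cons_val_one, map_add, MvPowerSeries.pderiv_X,
        Derivation.leibniz, pderiv_C, smul_eq_mul]
      simp
    change Ideal.span {MvPowerSeries.pderiv 0 (L a), MvPowerSeries.pderiv 1 (L a)} =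
      Ideal.span {L (MvPowerSeries.pderiv 0 a), L (MvPowerSeries.pderiv 1 a)}
    rw [h0', h1', Ideal.span_pair_add_mul_right]

/-- **THE SURFACE LEAF** (characteristic two, `n = 2`): for a state `a` of order `≥ 2` without
`x y`-term (the residual germ on the critical surface) and its isolated strict transform `G`
without linear terms, the Milnor number drops: Max Noether's inequality for `(∂ₓa, ∂_y a)`
together with the multiplicity of the exceptional line in `(∂G)`. [folklore] -/
theorem surface_drop [CharP κ 2] (τ : Fin 2 → κ) {a G : MvPowerSeries (Fin 2) κ}
    (ha : 2 ≤ a.order) (hnopair : coeff (Finsupp.single 0 1 + Finsupp.single 1 1) a = 0)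
    (hG : X 0 ^ 2 * G = subst (fun s => if s = (0 : Fin 2) then (X 0 : MvPowerSeries (Fin 2) κ)
      else X 0 * (X s + C (τ s))) a)
    (hfa : Module.Finite κ (MvPowerSeries (Fin 2) κ ⧸ Ideal.span (Set.range fun s => MvPowerSeries.pderiv s a)))
    (hfG : Module.Finite κ (MvPowerSeries (Fin 2) κ ⧸ Ideal.span (Set.range fun s => MvPowerSeries.pderiv s G))) :
    Module.finrank κ (MvPowerSeries (Fin 2) κ ⧸ Ideal.span (Set.range fun s => MvPowerSeries.pderiv s G)) <
      Module.finrank κ (MvPowerSeries (Fin 2) κ ⧸ Ideal.span (Set.range fun s => MvPowerSeries.pderiv s a)) := by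
  have range_fin_two : ∀ {α : Type} (h : Fin 2 → α), Set.range h = {h 0, h 1} := fun h => by
    ext x
    simp only [Set.mem_range, Set.mem_insert_iff, Set.mem_singleton_iff]
    constructor
    · rintro ⟨s, rfl⟩; fin_cases s <;> simp
    · rintro (rfl | rfl) <;> exact ⟨_, rfl⟩
  have finOne_eq_single : ∀ m : Fin 1 →₀ ℕ, m = Finsupp.single 0 (m 0) := fun m =>
    Finsupp.ext fun s => by fin_cases s; simp
  set e : Fin 1 ↪ Fin 2 := ⟨fun _ => (1 : Fin 2), fun a b _ => Subsingleton.elim a b⟩ with he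
  -- STEP 1: the shear
  rw [blowFam_two_eq_dirChart] at hG
  obtain ⟨a₁, ha₁, ha₁ord, ha₁pair, ⟨ε⟩⟩ := shear_transfer (τ 1) ha hnopair
  rw [ha₁] at hG
  rw [ε.toLinearEquiv.finrank_eq]
  haveI hfa₁ : Module.Finite κ (MvPowerSeries (Fin 2) κ ⧸
      Ideal.span (Set.range fun s => MvPowerSeries.pderiv s a₁)) := Module.Finite.equiv ε.toLinearEquiv
  clear hfa ha hnopair ha₁
  rw [range_fin_two] at hfa₁ ⊢
  rw [range_fin_two] at hfG ⊢
  -- the relation in the `τ = 0` family form, and the gradient relations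
  have hG' : X 0 ^ 2 * G = subst (fun s => if s = (0 : Fin 2) then (X 0 : MvPowerSeries (Fin 2) κ)
      else X 0 * (X s + C ((0 : Fin 2 → κ) s))) a₁ := by rw [blowFam_two_zero]; exact hG
  have hrel1 : X 0 * MvPowerSeries.pderiv 1 G = subst ![X 0, X 0 * X 1] (MvPowerSeries.pderiv 1 a₁) := by
    rw [← blowFam_two_zero]; exact X_mul_pderiv_strict_of_ne 0 0 (by decide) hG'
  have hrel0 : X 0 ^ 2 * MvPowerSeries.pderiv 0 G = subst ![X 0, X 0 * X 1] (MvPowerSeries.pderiv 0 a₁) +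
      X 1 * subst ![X 0, X 0 * X 1] (MvPowerSeries.pderiv 1 a₁) := by
    have := X_sq_mul_pderiv_strict_self 0 0 hG'
    rw [blowFam_two_zero] at this
    rw [this, show Finset.univ.erase (0 : Fin 2) = {1} by decide, Finset.sum_singleton, ← hrel1]
    simp
  -- STEP 2: the partials of `a₁`
  set f := MvPowerSeries.pderiv 0 a₁ with hf
  set g := MvPowerSeries.pderiv 1 a₁ with hg
  have hf2 : 2 ≤ f.order := two_le_order_pderiv_two ha₁ord ha₁pair 0
  have hg2 : 2 ≤ g.order := two_le_order_pderiv_two ha₁ord ha₁pair 1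
  have hfmem : f ∈ maximalIdeal (MvPowerSeries (Fin 2) κ) := by
    rw [Literature.RingTheory.MvPowerSeries.Jets.mem_maximalIdeal_iff_constantCoeff_eq_zero]
    exact ((FormalCoordChange.two_le_order_iff f).mp hf2).1
  have hgmem : g ∈ maximalIdeal (MvPowerSeries (Fin 2) κ) := by
    rw [Literature.RingTheory.MvPowerSeries.Jets.mem_maximalIdeal_iff_constantCoeff_eq_zero]
    exact ((FormalCoordChange.two_le_order_iff g).mp hg2).1
  have hf0 : f ≠ 0 := by
    intro h0
    rw [h0, Ideal.span_insert_zero] at hfa₁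
    exact not_finite_quot_span {g} (by simpa using hgmem) (by simp) (by rw [Finset.coe_singleton]; exact hfa₁)
  have hg0 : g ≠ 0 := by
    intro h0
    rw [h0, Ideal.span_pair_zero] at hfa₁
    exact not_finite_quot_span {f} (by simpa using hfmem) (by simp) (by rw [Finset.coe_singleton]; exact hfa₁)
  set mf := f.order.toNat with hmf
  set mg := g.order.toNat with hmg
  have hordf : (mf : ℕ∞) = f.order := ne_zero_iff_order_finite.mp hf0
  have hordg : (mg : ℕ∞) = g.order := ne_zero_iff_order_finite.mp hg0
  have hmf2 : 2 ≤ mf := by have := hf2; rw [← hordf] at this; exact_mod_cast this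
  have hmg2 : 2 ≤ mg := by have := hg2; rw [← hordg] at this; exact_mod_cast this
  obtain ⟨f', hff', hKf, hνf⟩ := exists_strict_transform hf0
  obtain ⟨g', hgg', hKg, hνg⟩ := exists_strict_transform hg0
  have hνf' : (killCompl e f').order.toNat ≤ mf := by
    have h := hνf; rw [← ne_zero_iff_order_finite.mp hKf] at h; exact_mod_cast h
  have hνg' : (killCompl e g').order.toNat ≤ mg := by
    have h := hνg; rw [← ne_zero_iff_order_finite.mp hKg] at h; exact_mod_cast h
  have hff'' : subst ![X 0, X 0 * X 1] f = X 0 ^ mf * f' := hff'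
  have hgg'' : subst ![X 0, X 0 * X 1] g = X 0 ^ mg * g' := hgg'
  have hpf : (X 0 : MvPowerSeries (Fin 2) κ) ^ mf = X 0 ^ 2 * X 0 ^ (mf - 2) := by
    rw [← pow_add]; congr 1; omega
  have hpg : (X 0 : MvPowerSeries (Fin 2) κ) ^ mg = X 0 ^ 2 * X 0 ^ (mg - 2) := by
    rw [← pow_add]; congr 1; omega
  -- the strict transforms are not divisible by `x`
  have hndvd : ∀ {h : MvPowerSeries (Fin 2) κ}, killCompl e h ≠ 0 → ¬ (X 0 : MvPowerSeries (Fin 2) κ) ∣ h := by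
    intro h hh ⟨w, hw⟩
    apply hh
    rw [hw, map_mul, killCompl_X_eq_zero (fun h' => ((range_axisEmb 0).mp h').1 rfl), zero_mul]
  -- `∂₁ G = x^{mg-1} g'`, `∂₀ G = x^{mf-2} f' + y x^{mg-2} g'`
  set H₀ := X 0 ^ (mf - 2) * f' with hH₀
  set H₁ := X 0 ^ (mg - 2) * g' with hH₁
  have hd1 : MvPowerSeries.pderiv 1 G = X 0 * H₁ := by
    apply MvPowerSeries.X_mul_cancel (i := (0 : Fin 2))
    rw [hrel1, hgg'', hH₁, hpg]; ring
  have hd0 : MvPowerSeries.pderiv 0 G = H₀ + X 1 * H₁ := by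
    have h2 : X 0 ^ 2 * MvPowerSeries.pderiv 0 G = X 0 ^ 2 * (H₀ + X 1 * H₁) := by
      rw [hrel0, hff'', hgg'', hH₀, hH₁, hpf, hpg]; ring
    rw [pow_two, mul_assoc, mul_assoc] at h2
    exact MvPowerSeries.X_mul_cancel (MvPowerSeries.X_mul_cancel h2)
  rw [hd0, hd1] at hfG ⊢
  set P := H₀ + X 1 * H₁ with hP
  -- `x ∤ ∂₀ G`
  have hPndvd : ¬ (X 0 : MvPowerSeries (Fin 2) κ) ∣ P := by
    intro hdvd
    refine not_finite_quot_of_le_span (I := Ideal.span {P, X 0 * H₁}) {X 0} ?_ (by simp) ?_ hfG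
    · simp only [Finset.coe_singleton, Set.singleton_subset_iff, SetLike.mem_coe]
      exact X_mem_maximalIdeal κ (Fin 2) 0
    · rw [Finset.coe_singleton, Ideal.span_le]
      intro z hz
      simp only [Set.mem_insert_iff, Set.mem_singleton_iff] at hz
      rcases hz with rfl | rfl
      · exact Ideal.mem_span_singleton.mpr hdvd
      · exact Ideal.mem_span_singleton.mpr (dvd_mul_right _ _)
  obtain ⟨hfinPx, hfinPH, hsum⟩ := colength_X_mul hPndvd hfG
  -- `ν = dim S/(P, x) ≤ 3`
  have hKP : killCompl e P ≠ 0 := by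
    intro h0
    apply hPndvd
    have hmem : P ∈ RingHom.ker (killCompl (R := κ) e : MvPowerSeries (Fin 2) κ →+* MvPowerSeries (Fin 1) κ) := h0
    have := ker_killCompl_le e range_axisEmb hmem
    rw [Set.pair_eq_singleton, Ideal.mem_span_singleton] at this
    exact this
  obtain ⟨-, hν⟩ := colength_X_eq_order hKP
  rw [Ideal.span_pair_comm] at hν
  change _ = (killCompl e P).order.toNat at hν
  have hν3 : (killCompl e P).order.toNat ≤ 3 := by
    obtain ⟨d, hd, hdeg⟩ := exists_coeff_ne_zero_and_order (ne_zero_iff_order_finite.mp hKP)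
    rw [finOne_eq_single d, Finsupp.degree_single] at hdeg
    have hq : d 0 ≤ 3 := by
      by_contra hlt
      apply hd
      rw [finOne_eq_single d, coeff_killCompl_axis, ← hd0, MvPowerSeries.coeff_pderiv]
      have hexp : (Finsupp.single 0 3 + Finsupp.single 1 (d 0) : Fin 2 →₀ ℕ) - Finsupp.single 0 2 =
          Finsupp.single 1 (d 0) + Finsupp.single 0 1 := by
        apply Finsupp.ext; intro s; fin_cases s <;> simp
      have h1 : coeff (Finsupp.single 1 (d 0) + Finsupp.single 0 1) G =
          coeff (Finsupp.single 0 3 + Finsupp.single 1 (d 0)) (X 0 ^ 2 * G) := by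
        rw [X_pow_eq, coeff_monomial_mul, if_pos, one_mul, hexp]
        rw [Finsupp.single_le_iff]; simp
      rw [h1, hG, coeff_subst_blow', (finTwo_pair_apply _ _).1, (finTwo_pair_apply _ _).2, if_neg (by omega),
        mul_zero]
    have : (killCompl e P).order.toNat = d 0 := by
      have := congrArg ENat.toNat hdeg
      simpa using this.symm
    omega
  -- not both orders are `≥ 3`
  have hcase : mf = 2 ∨ mg = 2 := by
    by_contra hc
    push Not at hc
    apply hPndvd
    rw [hP, hH₀, hH₁, show mf - 2 = (mf - 3) + 1 by omega, show mg - 2 = (mg - 3) + 1 by omega,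
      pow_succ, pow_succ]
    exact Dvd.intro (X 0 ^ (mf - 3) * f' + X 1 * (X 0 ^ (mg - 3) * g')) (by ring)
  -- Max Noether for `(f, g)`
  have hN : Module.Finite κ (MvPowerSeries (Fin 2) κ ⧸ Ideal.span {f', g'}) →
      Module.finrank κ (MvPowerSeries (Fin 2) κ ⧸ Ideal.span {f', g'}) + mf * mg ≤
        Module.finrank κ (MvPowerSeries (Fin 2) κ ⧸ Ideal.span {f, g}) := fun hfin' =>
    noether_inequality hordf.le hordg.le hff' hgg' hKf (hνf.trans (by exact_mod_cast Nat.le_add_right mf mg))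
      hfa₁ hfin'
  -- the two cases
  rcases hcase with hmf2' | hmg2'
  · -- `mf = 2`: `H₀ = f'`
    have hH₀' : H₀ = f' := by rw [hH₀, hmf2', Nat.sub_self, pow_zero, one_mul]
    have hspan : Ideal.span {P, H₁} = Ideal.span {f', X 0 ^ (mg - 2) * g'} := by
      rw [hP, Ideal.span_pair_add_mul_right, hH₀', hH₁]
    rw [hspan] at hfinPH hsum
    obtain ⟨hfin', hsum'⟩ := colength_X_pow_mul (hndvd hKf) (mg - 2) hfinPH
    obtain ⟨-, hρ⟩ := colength_X_eq_order hKf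
    rw [Ideal.span_pair_comm] at hρ
    change _ = (killCompl e f').order.toNat at hρ
    have hρ2 : Module.finrank κ (MvPowerSeries (Fin 2) κ ⧸ Ideal.span {f', (X 0 : MvPowerSeries (Fin 2) κ)}) ≤ 2 := by
      rw [hρ]; exact hνf'.trans hmf2'.le
    have hN' := hN hfin'
    rw [hmf2'] at hN'
    have hprod := Nat.mul_le_mul_left (mg - 2) hρ2
    rw [hsum, hν, hsum']
    omega
  · -- `mg = 2`: `H₁ = g'`
    have hH₁' : H₁ = g' := by rw [hH₁, hmg2', Nat.sub_self, pow_zero, one_mul]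
    have hspan : Ideal.span {P, H₁} = Ideal.span {g', X 0 ^ (mf - 2) * f'} := by
      rw [hP, Ideal.span_pair_add_mul_right, hH₁', hH₀, Ideal.span_pair_comm]
    rw [hspan] at hfinPH hsum
    obtain ⟨hfin', hsum'⟩ := colength_X_pow_mul (hndvd hKg) (mf - 2) hfinPH
    rw [Ideal.span_pair_comm (x := g') (y := f')] at hfin' hsum'
    obtain ⟨-, hρ⟩ := colength_X_eq_order hKg
    rw [Ideal.span_pair_comm] at hρ
    change _ = (killCompl e g').order.toNat at hρ
    have hρ2 : Module.finrank κ (MvPowerSeries (Fin 2) κ ⧸ Ideal.span {g', (X 0 : MvPowerSeries (Fin 2) κ)}) ≤ 2 := by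
      rw [hρ]; exact hνg'.trans hmg2'.le
    have hN' := hN hfin'
    rw [hmg2'] at hN'
    have hprod := Nat.mul_le_mul_left (mf - 2) hρ2
    rw [hsum, hν, hsum']
    omega

end Surface

end MuDropCharTwoOrdP

end Summit.ResolutionOfSingularities.ResolutionOfSingularities.Theorems.WildCones

end
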